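import Mathlib
import Summits.Ventures.HodgeRepro2.Incoherent

/-!
# T4Dimension — sub-claim B1 (the group + hermitian space + signatures): the dimension count

Kernel annex of route/T4-B1-p3.md §B1.5 (cell pub-hodge-repro2, owner p3). Liu 2021 App. C.1
(p. 108 ll. 30–33) gives the Shimura variety Sh(G, h_{V,Φ})_K the dimension Σ_{τ ∈ Φ_F} p_τ q_τ,
where (p_τ, q_τ) is the signature of V ⊗_{F,τ} ℝ. For the τ-nearby space V(τ) of a totally positive
definite datum of rank n (Def. C.4: signature (n−1, 1) at τ and (n, 0) elsewhere) this sum is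
(n−1)·1 + Σ_{τ′ ≠ τ} n·0 = n − 1, in agreement with «of dimension n − 1 over E» (p. 45 l. 56, p. 109
l. 55); for n = 3 the surface has dimension 2. Proved here in p2's local-invariant model
`HermitianLocalData` (Incoherent.lean): `dimension_nearby` and its n = 3 instance
`dimension_nearby_three`. Axioms: standard.
-/

namespace Summit.Ventures.HodgeRepro2.T4Dimension

open Summit.Ventures.HodgeRepro2.ShimuraData

variable {F K : Type*} [Field F] [NumberField F] [Field K] [NumberField K]

/-- Liu's dimension formula Σ_τ p_τ q_τ (p. 108 ll. 30–33) evaluated on a local-invariant datum. -/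
noncomputable def dimension {n : ℕ} (d : HermitianLocalData F K n) : ℕ :=
  ∑ w, (d.sig w).1 * (d.sig w).2

/-- A totally definite datum has dimension 0 (every q_τ = 0): the compact group U(n)^d has no
hermitian symmetric space. -/
theorem dimension_eq_zero_of_isTotallyDefinite {n : ℕ} (d : HermitianLocalData F K n)
    (hd : d.IsTotallyDefinite) : dimension d = 0 := by
  unfold dimension
  exact Finset.sum_eq_zero (fun w _ => by rw [hd w, mul_zero])

/-- The τ-nearby datum of a totally definite datum of rank m + 1 has dimension m: signature (m, 1)
at τ contributes m·1, every other place (m + 1, 0) contributes 0. -/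
theorem dimension_nearby {m : ℕ} (d : HermitianLocalData F K (m + 1)) (hd : d.IsTotallyDefinite)
    (τ : NumberField.InfinitePlace K) : dimension (d.nearby τ) = m := by
  unfold dimension
  classical
  rw [Finset.sum_eq_single τ]
  · show (Function.update d.sig τ (m, 1) τ).1 * (Function.update d.sig τ (m, 1) τ).2 = m
    rw [Function.update_self]
    exact mul_one m
  · intro w _ hw
    classical
    have hsig : ((d.nearby τ).sig w) = d.sig w := by
      show Function.update d.sig τ (m, 1) w = d.sig w
      exact Function.update_of_ne hw _ _
    rw [hsig, hd w, mul_zero]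
  · intro h
    exact absurd (Finset.mem_univ τ) h

/-- n = 3: the τ-nearby datum of a totally definite rank-3 datum — the hermitian space of the
compact Picard modular surface — has dimension 2 = n − 1 (Liu p. 45 l. 56: «of dimension n − 1»). -/
theorem dimension_nearby_three (d : HermitianLocalData F K 3) (hd : d.IsTotallyDefinite)
    (τ : NumberField.InfinitePlace K) : dimension (d.nearby τ) = 2 :=
  dimension_nearby d hd τ

end Summit.Ventures.HodgeRepro2.T4Dimension
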